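import Summits.ResolutionOfSingularities.ResolutionOfSingularities.Theorems.PurelyInseparableDim4ResConeShadeTwoCorner
import HarnessLib
import HarnessLib.Audit.Tags

/-!
# Purely inseparable four-folds — K2(p), PHASE `d = 2`, PART III: THE LEDGER FREEZES and the endgame lemmas of an all-corner
# shade-`2` chain (every prime; idea-4 I-4-5 (G1)–(G3), made `p`-free)

[OURS · counted 0 · cell `res-dim4-pi` · seat res-dim4-p-7 g3 · K2(p) lane (holder res-dim4-p-12 lineage; desk WORD #82 (c));
hand analysis res-dim4-idea-4 (cards I-4-4 / I-4-5).]  Nothing here proves K2(p), `NoIsolatedTrap p p`, or resolution of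
singularities in dimension ≥ 4 / characteristic `p`.  AI kernel work, weaker than expert review.

* §2 THE LEDGER FREEZES: a chart letter of co-weight `p − 1` needs a pure-power witness `x^{r + n e_j}`, `n ≥ 3`, which only a
  previous step in the SAME chart supplies (`chart_eq_of_coweight`, `chart_const_of_coweight`); so after a change of chart
  every chart letter has co-weight `≤ p − 2` and `W` is non-increasing (`degree_succ_le_of_change`).
* §3 ENDGAME LEMMAS at constant ledger `r` and stable quadric support `S₂` (from `T`): `no_pure_power_after_foreign_step`
  ((G1): no `x^{r+n e_a}` right after a step in another chart), `low_witness_after_foreign_step` (the only witnesses with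
  `|m| − m_a ≤ 1` right after a foreign step `c'` are `x^{r+3e_a+e_{c'}}` / `x^{r+2e_a+e_{c'}}`, sourced by `x^{r+3e_a}` /
  `x^{r+2e_a+e_{c'}}`), `own_step_source` (transport through a step in the letter's own chart).
Sequel: `…ResConeShadeTwoNoCornerTrap`.
bears_on: LADDER-RESOLUTION:D157-DOOR2 (res-dim4-pi · K2(p) · phase d = 2).  Supports stmt-ResolutionOfSingularities-16155
(helper).
-/

set_option linter.dupNamespace false -- mandated namespace of this single-conjunct summit

noncomputable section

namespace Summit.ResolutionOfSingularities.ResolutionOfSingularities.Theorems.PIDim4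

namespace ResCone

open MvPolynomial Finset
open Literature.AlgebraicGeometry.Resolution
open Literature.AlgebraicGeometry.Resolution.CentreBlowup
open Literature.AlgebraicGeometry.Resolution.Hauser2010
open Literature.AlgebraicGeometry.Resolution.HauserPerlega2019

variable {K : Type} [Field K] [DecidableEq K]

section Corner

variable {p : ℕ} [hp : Fact p.Prime] {c : ℕ → State K} {j : ℕ → Fin 4} {b : ℕ → Fin 4 → K}

/-! ## §2 The ledger freezes -/

/-- **A chart letter of co-weight `p − 1` locks the previous chart**: if `W_{k+1} = r_{k+1}(j_{k+1}) + p − 1` then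
`j k = j (k+1)` (its only low witness is a pure power `x^{r + n e_j}`, `n ≥ 3`, which a foreign corner step never produces).
[OURS · K2(p) phase d = 2] [folklore] -/
theorem chart_eq_of_coweight (hw : FreeTail.IsWitnessedChain p c j b)
    (hc : ∀ k, IsIsolated p (c k).F ∧ Step0 p (c k) (c (k + 1)) ∧ ordZero (c k).F ≠ p ∧ (c k).shade = 2)
    (hr0 : ∀ e ∈ (c 0).F.support, (c 0).r ≤ e) (hb : ∀ k, b k = 0) (k : ℕ)
    (hcw : (c (k + 1)).r.degree + 1 = (c (k + 1)).r (j (k + 1)) + p) : j k = j (k + 1) := by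
  set a := j (k + 1) with ha
  obtain ⟨m, hm, hm2, hlt⟩ := exists_axis_witness hc hr0 (k + 1) a
  -- the witness is a pure power of `x_a` above `x^r`
  have hma : m.degree = m a := by
    have h1 : m a ≤ m.degree := Finsupp.le_degree a m
    omega
  have hm0 : ∀ i, i ≠ a → m i = 0 := by
    intro i hia
    have := apply_add_apply_le_degree m hia
    omega
  have hmeq : m = Finsupp.single a (m a) := eq_single_of_forall m hm0
  -- not the quadric (`g_{k+1}` is `x_a`-free)
  have hn3 : 3 ≤ m a := by
    by_contra hlt3
    have hdeg2 : m.degree = 2 := by omega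
    have hμ := (mem_support_resForm_iff hc hr0 (k + 1) hdeg2).mpr hm
    have := (corner_quadric hw hc hr0 hb (k + 1)).2.1 m hμ
    rw [← ha] at this
    omega
  -- source under the corner step `k`
  obtain ⟨m₀, hm₀, hm₀2, hupd⟩ := corner_source hw hc hr0 hb k hm
  by_contra hne
  have hja : (m₀.update (j k) (m₀.degree - 2)) (j k) = m (j k) := by rw [← hupd]
  rw [Finsupp.update_apply, if_pos rfl, hm0 (j k) hne] at hja
  have haa : (m₀.update (j k) (m₀.degree - 2)) a = m a := by rw [← hupd]
  rw [Finsupp.update_apply, if_neg (fun h => hne h.symm)] at haa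
  have := Finsupp.le_degree a m₀
  omega

/-- **All earlier charts coincide with a chart letter of co-weight `p − 1`** (the letter's co-weight is preserved by its own
corner step). [OURS · K2(p) phase d = 2] [folklore] -/
theorem chart_const_of_coweight (hw : FreeTail.IsWitnessedChain p c j b)
    (hc : ∀ k, IsIsolated p (c k).F ∧ Step0 p (c k) (c (k + 1)) ∧ ordZero (c k).F ≠ p ∧ (c k).shade = 2)
    (hr0 : ∀ e ∈ (c 0).F.support, (c 0).r ≤ e) (hb : ∀ k, b k = 0) (k : ℕ)
    (hcw : (c k).r.degree + 1 = (c k).r (j k) + p) : ∀ i, i ≤ k → j i = j k := by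
  induction k with
  | zero => intro i hi; rw [Nat.le_zero.mp hi]
  | succ k ih =>
    intro i hi
    have hjk : j k = j (k + 1) := chart_eq_of_coweight hw hc hr0 hb k hcw
    rcases Nat.lt_or_ge i (k + 1) with hlt | hge
    · -- the co-weight of `j k = j (k+1)` is the same one step earlier
      obtain ⟨-, hr', hdeg, -⟩ := corner_step hw hc hr0 hb k
      obtain ⟨-, hpW, -⟩ := shadeTwo_letters p hc hr0 k
      have hrj : (c (k + 1)).r (j (k + 1)) = (c k).r.degree + 2 - p := by
        rw [hr', ← hjk, Finsupp.update_apply, if_pos rfl]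
      rw [← hjk] at hcw hrj
      have hcw' : (c k).r.degree + 1 = (c k).r (j k) + p := by omega
      rw [← hjk]
      exact ih hcw' i (by omega)
    · rw [le_antisymm hi hge]

/-- **After a change of chart every chart letter has co-weight `≤ p − 2`, so `W` is non-increasing.**
[OURS · K2(p) phase d = 2] [folklore] -/
theorem degree_succ_le_of_change (hw : FreeTail.IsWitnessedChain p c j b)
    (hc : ∀ k, IsIsolated p (c k).F ∧ Step0 p (c k) (c (k + 1)) ∧ ordZero (c k).F ≠ p ∧ (c k).shade = 2)
    (hr0 : ∀ e ∈ (c 0).F.support, (c 0).r ≤ e) (hb : ∀ k, b k = 0) {k₁ : ℕ} (hch : j k₁ ≠ j (k₁ + 1)) (k : ℕ)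
    (hk : k₁ < k) : (c k).r.degree + 2 ≤ (c k).r (j k) + p ∧ (c (k + 1)).r.degree ≤ (c k).r.degree := by
  have hc2 : ∀ k, IsIsolated p (c k).F ∧ Step0 p (c k) (c (k + 1)) := fun k => ⟨(hc k).1, (hc k).2.1⟩
  have hr : ∀ e ∈ (c k).F.support, (c k).r ≤ e := IsolatedBand.isolated_chain_forall_le hc2 hr0 k
  have htri := degree_lt_apply_add_of_isIsolated (hc k).1 hr (j k)
  obtain ⟨-, -, hdeg, -⟩ := corner_step hw hc hr0 hb k
  have hcw : (c k).r.degree + 2 ≤ (c k).r (j k) + p := by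
    by_contra hlt
    have heq : (c k).r.degree + 1 = (c k).r (j k) + p := by omega
    have hall := chart_const_of_coweight hw hc hr0 hb k heq
    exact hch ((hall k₁ hk.le).trans (hall (k₁ + 1) (by omega)).symm)
  exact ⟨hcw, by omega⟩

/-! ## §3 The endgame at constant ledger -/

section Endgame

variable {r : Fin 4 →₀ ℕ} {W : ℕ} {S₂ : Finset (Fin 4 →₀ ℕ)} {T : ℕ}

/-- **No pure power of a stable-free letter right after a foreign step**: if `a ≠ j k`, no monomial of the stable quadric
involves `x_a`, then `x^{r + n e_a} ∉ supp F_{k+1}` for `n ≥ 1`. [OURS · K2(p) phase d = 2] [folklore] -/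
theorem no_pure_power_after_foreign_step (hw : FreeTail.IsWitnessedChain p c j b)
    (hc : ∀ k, IsIsolated p (c k).F ∧ Step0 p (c k) (c (k + 1)) ∧ ordZero (c k).F ≠ p ∧ (c k).shade = 2)
    (hr0 : ∀ e ∈ (c 0).F.support, (c 0).r ≤ e) (hb : ∀ k, b k = 0) (hrr : ∀ k, (c k).r = r)
    (hS : ∀ k, T ≤ k → (resForm (c k)).support = S₂) {k : ℕ} (hk : T ≤ k) {a : Fin 4} (ha : a ≠ j k)
    (haS : ∀ μ ∈ S₂, μ a = 0) {n : ℕ} (hn : 1 ≤ n) : r + Finsupp.single a n ∉ (c (k + 1)).F.support := by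
  intro hmem
  have hm' : (c (k + 1)).r + Finsupp.single a n ∈ (c (k + 1)).F.support := by rw [hrr]; exact hmem
  obtain ⟨m, hm, hm2, hupd⟩ := corner_source hw hc hr0 hb k hm'
  obtain ⟨hmj, hmi⟩ := apply_of_eq_update hupd
  rw [Finsupp.single_apply, if_neg ha] at hmj
  have hdeg : m.degree = 2 := by omega
  have hμ : m ∈ S₂ := by
    rw [← hS k hk]
    exact (mem_support_resForm_iff hc hr0 k hdeg).mpr hm
  have hma : m a = 0 := haS m hμ
  have ha' := hmi a ha
  rw [Finsupp.single_eq_same, hma] at ha'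
  omega

/-- **Low witnesses right after a foreign step**: if `a ≠ j k =: c'` is stable-free, `T ≤ k`, and `x^{r + m′} ∈ supp F_{k+1}`
has `|m′| − m′_a ≤ 1`, then `m′ = 3e_a + e_{c'}` with `x^{r+3e_a} ∈ supp F_k`, or `m′ = 2e_a + e_{c'}` with
`x^{r + 2e_a + e_{c'}} ∈ supp F_k`. [OURS · K2(p) phase d = 2] [folklore] -/
theorem low_witness_after_foreign_step (hw : FreeTail.IsWitnessedChain p c j b)
    (hc : ∀ k, IsIsolated p (c k).F ∧ Step0 p (c k) (c (k + 1)) ∧ ordZero (c k).F ≠ p ∧ (c k).shade = 2)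
    (hr0 : ∀ e ∈ (c 0).F.support, (c 0).r ≤ e) (hb : ∀ k, b k = 0) (hrr : ∀ k, (c k).r = r)
    (hS : ∀ k, T ≤ k → (resForm (c k)).support = S₂) {k : ℕ} (hk : T ≤ k) {a : Fin 4} (ha : a ≠ j k)
    (haS : ∀ μ ∈ S₂, μ a = 0) {m' : Fin 4 →₀ ℕ} (hm' : r + m' ∈ (c (k + 1)).F.support)
    (hlow : m'.degree ≤ m' a + 1) :
    (m' = Finsupp.single a 3 + Finsupp.single (j k) 1 ∧ r + Finsupp.single a 3 ∈ (c k).F.support) ∨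
      (m' = Finsupp.single a 2 + Finsupp.single (j k) 1 ∧
        r + Finsupp.single a 2 + Finsupp.single (j k) 1 ∈ (c k).F.support) := by
  have hm'' : (c (k + 1)).r + m' ∈ (c (k + 1)).F.support := by rw [hrr]; exact hm'
  obtain ⟨m, hm, hm2, hupd⟩ := corner_source hw hc hr0 hb k hm''
  obtain ⟨hmj, hmi⟩ := apply_of_eq_update hupd
  have hma : m' a = m a := hmi a ha
  have hdeg' := degree_update_add m (j k) (m.degree - 2)
  rw [← hupd] at hdeg'
  have hle2 := apply_add_apply_le_degree m ha
  rcases Nat.lt_or_ge m.degree 3 with hlt3 | hge3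
  · -- `|m| = 2`: a monomial of the stable quadric, free of `a` and of the chart letter
    exfalso
    have hdeg2 : m.degree = 2 := by omega
    have hμ : m ∈ (resForm (c k)).support := (mem_support_resForm_iff hc hr0 k hdeg2).mpr hm
    have h1 : m (j k) = 0 := (corner_quadric hw hc hr0 hb k).2.1 m hμ
    have h2 : m a = 0 := haS m (by rw [← hS k hk]; exact hμ)
    omega
  · have hdeg3 : m.degree = 3 := by omega
    have hsum : m.degree = m a + m (j k) := by omega
    have hrest := apply_eq_zero_of_degree_eq m ha hsum
    have hmeq := eq_single_add_single_of_forall m ha hrest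
    have hstabk : (resForm (c (k + 1))).support = (resForm (c k)).support := by
      rw [hS (k + 1) (by omega), hS k hk]
    obtain ⟨hnb, -⟩ := no_birth hw hc hr0 hb k hstabk
    have hcube := no_cube hw hc hr0 hb k
    rcases (show m a = 0 ∨ m a = 1 ∨ m a = 2 ∨ m a = 3 by omega) with h0 | h1 | h2 | h3
    · exfalso
      have hjk : m (j k) = 3 := by omega
      rw [h0, hjk, Finsupp.single_zero, zero_add] at hmeq
      exact hcube (hmeq ▸ hm)
    · exfalso
      have hjk : m (j k) = 2 := by omega
      rw [h1, hjk, add_comm] at hmeq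
      exact hnb a ha (by rw [add_assoc, ← hmeq]; exact hm)
    · right
      have hjk : m (j k) = 1 := by omega
      rw [h2, hjk] at hmeq
      refine ⟨?_, ?_⟩
      · ext i
        by_cases hi : i = j k
        · rw [hi, hmj, hdeg3, Finsupp.add_apply, Finsupp.single_apply, if_neg ha, Finsupp.single_eq_same]
        · rw [hmi i hi, hmeq]
      · rw [← hrr k, add_assoc, ← hmeq]; exact hm
    · left
      have hjk : m (j k) = 0 := by omega
      rw [h3, hjk, Finsupp.single_zero, add_zero] at hmeq
      refine ⟨?_, ?_⟩
      · ext i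
        by_cases hi : i = j k
        · rw [hi, hmj, hdeg3, Finsupp.add_apply, Finsupp.single_apply, if_neg ha, Finsupp.single_eq_same]
        · rw [hmi i hi, hmeq, Finsupp.add_apply, Finsupp.single_apply (a := j k), if_neg (fun h => hi h.symm),
            add_zero]
      · rw [← hrr k, ← hmeq]; exact hm

/-- **Transport through an own step**: at an `a`-step, `x^{r + n e_a + e_c} ∈ supp F_{k+1}` (`c ≠ a`) forces
`x^{r + (n+1) e_a + e_c} ∈ supp F_k`, and `x^{r + n e_a} ∈ supp F_{k+1}` forces `x^{r + (n+2) e_a} ∈ supp F_k`.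
[OURS · K2(p) phase d = 2] [folklore] -/
theorem own_step_source (hw : FreeTail.IsWitnessedChain p c j b)
    (hc : ∀ k, IsIsolated p (c k).F ∧ Step0 p (c k) (c (k + 1)) ∧ ordZero (c k).F ≠ p ∧ (c k).shade = 2)
    (hr0 : ∀ e ∈ (c 0).F.support, (c 0).r ≤ e) (hb : ∀ k, b k = 0) (hrr : ∀ k, (c k).r = r) (k : ℕ) :
    (∀ (c' : Fin 4) (n : ℕ), c' ≠ j k → r + Finsupp.single (j k) n + Finsupp.single c' 1 ∈ (c (k + 1)).F.support →
        r + Finsupp.single (j k) (n + 1) + Finsupp.single c' 1 ∈ (c k).F.support) ∧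
      ∀ n : ℕ, r + Finsupp.single (j k) n ∈ (c (k + 1)).F.support →
        r + Finsupp.single (j k) (n + 2) ∈ (c k).F.support := by
  refine ⟨fun c' n hc' hmem => ?_, fun n hmem => ?_⟩
  · have hm' : (c (k + 1)).r + (Finsupp.single (j k) n + Finsupp.single c' 1) ∈ (c (k + 1)).F.support := by
      rw [hrr, ← add_assoc]; exact hmem
    obtain ⟨m, hm, hm2, hupd⟩ := corner_source hw hc hr0 hb k hm'
    obtain ⟨hmj, hmi⟩ := apply_of_eq_update hupd
    rw [Finsupp.add_apply, Finsupp.single_eq_same, Finsupp.single_apply, if_neg hc'] at hmj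
    have hc'v : m c' = 1 := by
      have := hmi c' hc'
      rw [Finsupp.add_apply, Finsupp.single_apply, if_neg (fun h => hc' h.symm), Finsupp.single_eq_same] at this
      exact this.symm
    have hrest : ∀ i, i ≠ j k → i ≠ c' → m i = 0 := by
      intro i hi hic
      have := hmi i hi
      rw [Finsupp.add_apply, Finsupp.single_apply, if_neg (fun h => hi h.symm), Finsupp.single_apply,
        if_neg (fun h => hic h.symm), add_zero] at this
      exact this.symm
    have hmeq := eq_single_add_single_of_forall m (fun h => hc' h.symm) hrest
    have hdegm : m.degree = m (j k) + m c' := by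
      conv_lhs => rw [hmeq]
      rw [map_add, Finsupp.degree_single, Finsupp.degree_single]
    have hjv : m (j k) = n + 1 := by omega
    rw [hjv, hc'v] at hmeq
    rw [← hrr k, add_assoc, ← hmeq]
    exact hm
  · have hm' : (c (k + 1)).r + Finsupp.single (j k) n ∈ (c (k + 1)).F.support := by rw [hrr]; exact hmem
    obtain ⟨m, hm, hm2, hupd⟩ := corner_source hw hc hr0 hb k hm'
    obtain ⟨hmj, hmi⟩ := apply_of_eq_update hupd
    rw [Finsupp.single_eq_same] at hmj
    have hrest : ∀ i, i ≠ j k → m i = 0 := by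
      intro i hi
      have := hmi i hi
      rw [Finsupp.single_apply, if_neg (fun h => hi h.symm)] at this
      exact this.symm
    have hmeq := eq_single_of_forall m hrest
    have hdegm : m.degree = m (j k) := by
      conv_lhs => rw [hmeq]
      rw [Finsupp.degree_single]
    have hjv : m (j k) = n + 2 := by omega
    rw [hjv] at hmeq
    rw [← hrr k, ← hmeq]
    exact hm

end Endgame

end Corner

end ResCone

end Summit.ResolutionOfSingularities.ResolutionOfSingularities.Theorems.PIDim4

end
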